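import Mathlib
import Summits.PneNP.PneNP.Cruxes.FoolingMeasure.IdeasR2s2g9

/-!
# Giant-footprint theorem for residue-graded halves (pnp-ideate seat p4, g17) — `stmt-PneNP-19727`

Crux `Summit.PneNP.PneNP.Theses.AeaCutRectangles.FoolingMeasure` (X1), route `route-PneNP-AeaCutRectangles`.
FRONTIER / restricted-model rung (AEA cut-rectangle protocols vs NON-3-COL).  Nothing here bears on P vs NP.

## What this file proves (kernel-checked, no `sorry`)

The cell's live question P1 (IDEATION-CENSUS-r2s2g14 §3/§7, BarrierNotesP4g16 §10.7) asks whether the light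
(3-colourable) pairs among ALIGNED + FORCED hybrids `H = S_A ∪ S'[B]` of normal cycle systems can be removed by an
affordable PRODUCT condition (a junta on Alice's class × a junta on Bob's class).  Seat 2's censuses found that every
light forced hybrid in reach of SAT solving is a SHALLOW seam repair (Type U/D, `|{q ≠ 0}| ≤ 9`) and that a row-side
pattern junta removes them at the rate level (0 / 10 818).  A rate is not a rectangle: a rectangle needs a DETERMINISTIC
darkness argument.  This file supplies the deterministic half that juntas CAN deliver, in the sharpest form, and thereby
isolates what they cannot.

Setting (abstract — no normality is needed on Bob's side).  `V` a finite vertex type, `B : Finset V` the cut,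
`r : V → ZMod 3` ANY residue function (in the application: Alice's frame-`k` residues `pos_k mod 3`, which agree with
Bob's on `B` in the aligned class), and Bob's edges inside `B`.  In `ZMod 3` every edge `{u,w}` is either an `r`-ARC
(`r w = r u + 1`, oriented `u → w`) or an `r`-SITE (`r u = r w`).  Writing any colouring as `c = r + q`
(`q : V → ZMod 3` the PHASE), properness along an arc says `q` stays or advances by one
(`IdeasR2s2g9.phase_step_of_proper`, seat 2 g9 — imported, not restated).  For a base phase `q₀` put
`Y₁ = {y ∈ B : q y = q₀ + 1}`, `Y₂ = {y ∈ B : q y = q₀ + 2}`, `Y = Y₁ ∪ Y₂ = {y ∈ B : q y ≠ q₀}` (the frame-`k`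
FOOTPRINT of the colouring on Bob's side, relative to `q₀`).

* `out_closed` / `in_closed` : every Bob arc out of `Y₁` ends in `Y`; every Bob arc into `Y₂` starts in `Y`.
* `two_mul_card_inside_ge`  : hence `2·#(Bob arcs inside Y) ≥ Σ_{Y₁} outdeg + Σ_{Y₂} indeg ≥ δ·|Y|` when every
                               `y ∈ B` has frame out-degree and in-degree `≥ δ` among Bob's arcs.
* `giant_footprint`          : if moreover Bob's side is LOCALLY SPARSE — every `Y ⊆ B` with `|Y| ≤ c` spans fewer than
                               `(δ/2)·|Y|` arcs — then `Y = ∅` or `|Y| > c`.  FOR EVERY base phase `q₀`.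
* `phase_classes`            : corollary — either the phase `q` is CONSTANT on `B`, or EVERY phase class misses more
                               than `c` vertices of `B` (a "giant winding").
* `giant_footprint_of_colouring` : the same read off an arbitrary proper `ZMod 3`-colouring of an arbitrary graph whose
                               Bob part lives inside `B` (the phase rule is derived, not assumed).
* `frozen_split`             : the constant-on-`B` case is ONE-SIDED: `c = r + q` with `q|_B ≡ a` is proper on
                               `α ⊔ β` iff it is proper on Alice's `α` alone and `β` has no `r`-site — an Alice-checkable
                               event ("Alice repair-free"), affordable by the cell's law B-g14s2-2.

ERRATUM (same day, §6b below): frames of NORMAL systems are height-graded, so `δ ≥ 2` is never satisfiable there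
(`not_bj_two_of_graded`); the paragraph that follows describes the abstract/ungraded reading only, and the memo v2
replaces its cost sheet.  Original text:
Consequence for P1 (memo `BarrierNotesP4g17.md`): with `δ = 3` and the standard local-sparsity of sparse random-like
halves (`η = 1/2`, `c = c(t)·n`), the Bob-junta «frame in/out-degree ≥ 3 everywhere + local sparsity» and the
Alice-junta «repair-free + seams in A + FORCED» cost `O(n)` bits at fixed `t` (affordable against the
`(n/2)·log₂ n` purse) and kill, DETERMINISTICALLY and at every depth, every Type-U/D repair, every double-break repair
and every colouring whose footprint on `B` is `≤ c(t)·n` in some frame and some normalisation.  What survives is exactly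
the GIANT three-phase windings; P1 = their rate / product-capturability (a second-cluster question for a planted CSP),
no longer a question about seam-zone patterns.  The theorem is blind to heights, zones and staircases: it is the
"grading-based decision procedure" asked for in census r2s2g14, with the grading used only on Alice's side.
-/

set_option linter.dupNamespace false
set_option linter.unusedSectionVars false

namespace Summit.PneNP.PneNP.Cruxes.FoolingMeasure.P4g17

open Finset
open Summit.PneNP.PneNP.Cruxes.FoolingMeasure.IdeasR2s2g9 (phase_step_of_proper)

variable {V : Type*} [DecidableEq V]

/-! ## §1 Arc systems inside the cut and the cyclic phase rule -/

/-- out-arcs of `y` in the arc set `E`. -/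
def outArcs (E : Finset (V × V)) (y : V) : Finset (V × V) := E.filter fun e => e.1 = y

/-- in-arcs of `y` in the arc set `E`. -/
def inArcs (E : Finset (V × V)) (y : V) : Finset (V × V) := E.filter fun e => e.2 = y

/-- arcs of `E` with both endpoints in `Y`. -/
def inside (E : Finset (V × V)) (Y : Finset V) : Finset (V × V) := E.filter fun e => e.1 ∈ Y ∧ e.2 ∈ Y

/-- the CYCLIC RULE: along every arc the phase stays or advances by one (`mod 3`). -/
def CyclicOn (E : Finset (V × V)) (q : V → ZMod 3) : Prop :=
  ∀ e ∈ E, q e.2 = q e.1 ∨ q e.2 = q e.1 + 1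

/-- the vertices of `B` in phase `a`. -/
def phaseClass (B : Finset V) (q : V → ZMod 3) (a : ZMod 3) : Finset V := B.filter fun y => q y = a

/-- the FOOTPRINT relative to the base phase `q₀`: vertices of `B` off phase `q₀`. -/
def footprint (B : Finset V) (q : V → ZMod 3) (q₀ : ZMod 3) : Finset V := B.filter fun y => q y ≠ q₀

theorem mem_phaseClass {B : Finset V} {q : V → ZMod 3} {a : ZMod 3} {y : V} :
    y ∈ phaseClass B q a ↔ y ∈ B ∧ q y = a := by
  simp [phaseClass]

theorem mem_footprint {B : Finset V} {q : V → ZMod 3} {q₀ : ZMod 3} {y : V} :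
    y ∈ footprint B q q₀ ↔ y ∈ B ∧ q y ≠ q₀ := by
  simp [footprint]

theorem zmod3_ne_iff (x a : ZMod 3) : x ≠ a ↔ (x = a + 1 ∨ x = a + 2) := by
  revert x a; decide

/-- `Y = Y₁ ∪ Y₂`. -/
theorem footprint_eq_union (B : Finset V) (q : V → ZMod 3) (q₀ : ZMod 3) :
    footprint B q q₀ = phaseClass B q (q₀ + 1) ∪ phaseClass B q (q₀ + 2) := by
  ext y
  simp only [mem_footprint, Finset.mem_union, mem_phaseClass]
  rw [zmod3_ne_iff]
  tauto

theorem disjoint_phaseClass (B : Finset V) (q : V → ZMod 3) (q₀ : ZMod 3) :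
    Disjoint (phaseClass B q (q₀ + 1)) (phaseClass B q (q₀ + 2)) := by
  rw [Finset.disjoint_left]
  intro y h1 h2
  rw [mem_phaseClass] at h1 h2
  have key : ∀ a : ZMod 3, a + 1 ≠ a + 2 := by decide
  exact key q₀ (h1.2.symm.trans h2.2)

theorem card_footprint (B : Finset V) (q : V → ZMod 3) (q₀ : ZMod 3) :
    (footprint B q q₀).card = (phaseClass B q (q₀ + 1)).card + (phaseClass B q (q₀ + 2)).card := by
  rw [footprint_eq_union, Finset.card_union_of_disjoint (disjoint_phaseClass B q q₀)]

/-! ## §2 Closure of the footprint under Bob's arcs -/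

/-- Every arc OUT OF `Y₁` ends in the footprint. -/
theorem out_closed {E : Finset (V × V)} {B : Finset V} (hE : ∀ e ∈ E, e.1 ∈ B ∧ e.2 ∈ B)
    {q : V → ZMod 3} (hq : CyclicOn E q) (q₀ : ZMod 3) {e : V × V} (he : e ∈ E)
    (h1 : e.1 ∈ phaseClass B q (q₀ + 1)) : e.2 ∈ footprint B q q₀ := by
  rw [mem_phaseClass] at h1
  rw [mem_footprint]
  refine ⟨(hE e he).2, ?_⟩
  have key : ∀ a b c : ZMod 3, (b = a ∨ b = a + 1) → a = c + 1 → b ≠ c := by decide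
  exact key (q e.1) (q e.2) q₀ (hq e he) h1.2

/-- Every arc INTO `Y₂` starts in the footprint. -/
theorem in_closed {E : Finset (V × V)} {B : Finset V} (hE : ∀ e ∈ E, e.1 ∈ B ∧ e.2 ∈ B)
    {q : V → ZMod 3} (hq : CyclicOn E q) (q₀ : ZMod 3) {e : V × V} (he : e ∈ E)
    (h2 : e.2 ∈ phaseClass B q (q₀ + 2)) : e.1 ∈ footprint B q q₀ := by
  rw [mem_phaseClass] at h2
  rw [mem_footprint]
  refine ⟨(hE e he).1, ?_⟩
  have key : ∀ a b c : ZMod 3, (b = a ∨ b = a + 1) → b = c + 2 → a ≠ c := by decide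
  exact key (q e.1) (q e.2) q₀ (hq e he) h2.2

/-- No arc from `Y₂` to `Y₁` (recorded for completeness; not used below). -/
theorem no_arc_two_one {E : Finset (V × V)} {B : Finset V}
    {q : V → ZMod 3} (hq : CyclicOn E q) (q₀ : ZMod 3) {e : V × V} (he : e ∈ E)
    (h2 : e.1 ∈ phaseClass B q (q₀ + 2)) : e.2 ∉ phaseClass B q (q₀ + 1) := by
  rw [mem_phaseClass] at h2 ⊢
  have key : ∀ a b c : ZMod 3, (b = a ∨ b = a + 1) → a = c + 2 → b ≠ c + 1 := by decide
  exact fun h => key (q e.1) (q e.2) q₀ (hq e he) h2.2 h.2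

/-- The out-arcs of `Y₁` lie inside the footprint. -/
theorem biUnion_outArcs_subset {E : Finset (V × V)} {B : Finset V} (hE : ∀ e ∈ E, e.1 ∈ B ∧ e.2 ∈ B)
    {q : V → ZMod 3} (hq : CyclicOn E q) (q₀ : ZMod 3) :
    (phaseClass B q (q₀ + 1)).biUnion (outArcs E) ⊆ inside E (footprint B q q₀) := by
  intro e he
  rw [Finset.mem_biUnion] at he
  obtain ⟨y, hy, hey⟩ := he
  simp only [outArcs, Finset.mem_filter] at hey
  obtain ⟨heE, rfl⟩ := hey
  simp only [inside, Finset.mem_filter]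
  refine ⟨heE, ?_, out_closed hE hq q₀ heE hy⟩
  rw [footprint_eq_union, Finset.mem_union]
  exact Or.inl hy

/-- The in-arcs of `Y₂` lie inside the footprint. -/
theorem biUnion_inArcs_subset {E : Finset (V × V)} {B : Finset V} (hE : ∀ e ∈ E, e.1 ∈ B ∧ e.2 ∈ B)
    {q : V → ZMod 3} (hq : CyclicOn E q) (q₀ : ZMod 3) :
    (phaseClass B q (q₀ + 2)).biUnion (inArcs E) ⊆ inside E (footprint B q q₀) := by
  intro e he
  rw [Finset.mem_biUnion] at he
  obtain ⟨y, hy, hey⟩ := he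
  simp only [inArcs, Finset.mem_filter] at hey
  obtain ⟨heE, rfl⟩ := hey
  simp only [inside, Finset.mem_filter]
  refine ⟨heE, in_closed hE hq q₀ heE hy, ?_⟩
  rw [footprint_eq_union, Finset.mem_union]
  exact Or.inr hy

/-! ## §3 Counting: the footprint spans many arcs -/

theorem card_biUnion_outArcs (E : Finset (V × V)) (S : Finset V) :
    (S.biUnion (outArcs E)).card = ∑ y ∈ S, (outArcs E y).card := by
  apply Finset.card_biUnion
  intro x _ y _ hxy
  show Disjoint (outArcs E x) (outArcs E y)
  rw [Finset.disjoint_left]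
  intro e hex hey
  simp only [outArcs, Finset.mem_filter] at hex hey
  exact hxy (hex.2.symm.trans hey.2)

theorem card_biUnion_inArcs (E : Finset (V × V)) (S : Finset V) :
    (S.biUnion (inArcs E)).card = ∑ y ∈ S, (inArcs E y).card := by
  apply Finset.card_biUnion
  intro x _ y _ hxy
  show Disjoint (inArcs E x) (inArcs E y)
  rw [Finset.disjoint_left]
  intro e hex hey
  simp only [inArcs, Finset.mem_filter] at hex hey
  exact hxy (hex.2.symm.trans hey.2)

/-- Out-degree count: `δ·|Y₁| ≤ #arcs inside Y`. -/
theorem delta_mul_card_one_le {E : Finset (V × V)} {B : Finset V} (hE : ∀ e ∈ E, e.1 ∈ B ∧ e.2 ∈ B)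
    {q : V → ZMod 3} (hq : CyclicOn E q) (q₀ : ZMod 3) {δ : ℕ}
    (hout : ∀ y ∈ B, δ ≤ (outArcs E y).card) :
    δ * (phaseClass B q (q₀ + 1)).card ≤ (inside E (footprint B q q₀)).card := by
  calc δ * (phaseClass B q (q₀ + 1)).card
      = ∑ _y ∈ phaseClass B q (q₀ + 1), δ := by rw [Finset.sum_const, smul_eq_mul, mul_comm]
    _ ≤ ∑ y ∈ phaseClass B q (q₀ + 1), (outArcs E y).card := by
        apply Finset.sum_le_sum
        intro y hy
        exact hout y (mem_phaseClass.mp hy).1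
    _ = ((phaseClass B q (q₀ + 1)).biUnion (outArcs E)).card := (card_biUnion_outArcs E _).symm
    _ ≤ (inside E (footprint B q q₀)).card := Finset.card_le_card (biUnion_outArcs_subset hE hq q₀)

/-- In-degree count: `δ·|Y₂| ≤ #arcs inside Y`. -/
theorem delta_mul_card_two_le {E : Finset (V × V)} {B : Finset V} (hE : ∀ e ∈ E, e.1 ∈ B ∧ e.2 ∈ B)
    {q : V → ZMod 3} (hq : CyclicOn E q) (q₀ : ZMod 3) {δ : ℕ}
    (hin : ∀ y ∈ B, δ ≤ (inArcs E y).card) :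
    δ * (phaseClass B q (q₀ + 2)).card ≤ (inside E (footprint B q q₀)).card := by
  calc δ * (phaseClass B q (q₀ + 2)).card
      = ∑ _y ∈ phaseClass B q (q₀ + 2), δ := by rw [Finset.sum_const, smul_eq_mul, mul_comm]
    _ ≤ ∑ y ∈ phaseClass B q (q₀ + 2), (inArcs E y).card := by
        apply Finset.sum_le_sum
        intro y hy
        exact hin y (mem_phaseClass.mp hy).1
    _ = ((phaseClass B q (q₀ + 2)).biUnion (inArcs E)).card := (card_biUnion_inArcs E _).symm
    _ ≤ (inside E (footprint B q q₀)).card := Finset.card_le_card (biUnion_inArcs_subset hE hq q₀)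

/-- THE DENSITY INEQUALITY: `δ·|Y| ≤ 2·#(arcs inside Y)` for the footprint `Y` of any phase function obeying the
cyclic rule on Bob's arcs, whenever every vertex of `B` has out- and in-degree `≥ δ`. -/
theorem two_mul_card_inside_ge {E : Finset (V × V)} {B : Finset V} (hE : ∀ e ∈ E, e.1 ∈ B ∧ e.2 ∈ B)
    {q : V → ZMod 3} (hq : CyclicOn E q) (q₀ : ZMod 3) {δ : ℕ}
    (hout : ∀ y ∈ B, δ ≤ (outArcs E y).card) (hin : ∀ y ∈ B, δ ≤ (inArcs E y).card) :
    δ * (footprint B q q₀).card ≤ 2 * (inside E (footprint B q q₀)).card := by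
  have h1 := delta_mul_card_one_le hE hq q₀ hout
  have h2 := delta_mul_card_two_le hE hq q₀ hin
  rw [card_footprint, mul_add]
  omega

/-! ## §4 The giant-footprint theorem -/

/-- LOCAL SPARSITY of Bob's arcs at scale `c` and density `δ/2`: every nonempty `Y ⊆ B` with `|Y| ≤ c` spans fewer
than `(δ/2)·|Y|` arcs.  (For the Bob side of a random-like `t`-system and `δ = 3` this holds with `c = c(t)·n`,
failure probability `O(n^{-1/2})`; memo §2.) -/
def LocallySparse (E : Finset (V × V)) (B : Finset V) (δ c : ℕ) : Prop :=
  ∀ Y ⊆ B, Y.Nonempty → Y.card ≤ c → 2 * (inside E Y).card < δ * Y.card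

theorem footprint_subset (B : Finset V) (q : V → ZMod 3) (q₀ : ZMod 3) : footprint B q q₀ ⊆ B :=
  Finset.filter_subset _ _

/-- GIANT FOOTPRINT.  Under min frame-degree `δ` and local sparsity at scale `c`, the footprint of every phase
function obeying the cyclic rule on Bob's arcs is EMPTY or has MORE THAN `c` vertices — for every base phase. -/
theorem giant_footprint {E : Finset (V × V)} {B : Finset V} (hE : ∀ e ∈ E, e.1 ∈ B ∧ e.2 ∈ B)
    {q : V → ZMod 3} (hq : CyclicOn E q) {δ c : ℕ}
    (hout : ∀ y ∈ B, δ ≤ (outArcs E y).card) (hin : ∀ y ∈ B, δ ≤ (inArcs E y).card)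
    (hsparse : LocallySparse E B δ c) (q₀ : ZMod 3) :
    footprint B q q₀ = ∅ ∨ c < (footprint B q q₀).card := by
  by_cases hY : footprint B q q₀ = ∅
  · exact Or.inl hY
  · right
    by_contra hc
    have hc' : (footprint B q q₀).card ≤ c := not_lt.mp hc
    have hlt := hsparse _ (footprint_subset B q q₀) (Finset.nonempty_iff_ne_empty.mpr hY) hc'
    have hge := two_mul_card_inside_ge hE hq q₀ hout hin
    omega

/-- BOUNDED-DEPTH KILLS WITHOUT SPARSITY.  (i) `δ ≥ 1`: a nonempty footprint spans at least one Bob arc — so a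
Type-U terminator with no Bob in-arc together with chain vertices without Bob out-arcs (footprint spanning NO arc) is
impossible; (ii) `δ ≥ 2`: the footprint spans at least as many arcs as it has vertices, hence contains a cycle of Bob's
graph — so under girth `g` of `S'[B]` (an `O(c^g)`-bit Bob condition) every light colouring has footprint `≥ g` in every
frame and normalisation. -/
theorem footprint_spans_arcs {E : Finset (V × V)} {B : Finset V} (hE : ∀ e ∈ E, e.1 ∈ B ∧ e.2 ∈ B)
    {q : V → ZMod 3} (hq : CyclicOn E q) (q₀ : ZMod 3)
    (hout : ∀ y ∈ B, 1 ≤ (outArcs E y).card) (hin : ∀ y ∈ B, 1 ≤ (inArcs E y).card)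
    (hY : (footprint B q q₀).Nonempty) : (inside E (footprint B q q₀)).Nonempty := by
  have hge := two_mul_card_inside_ge hE hq q₀ hout hin
  have hpos : 0 < (footprint B q q₀).card := Finset.card_pos.mpr hY
  apply Finset.card_pos.mp
  omega

theorem card_le_card_inside {E : Finset (V × V)} {B : Finset V} (hE : ∀ e ∈ E, e.1 ∈ B ∧ e.2 ∈ B)
    {q : V → ZMod 3} (hq : CyclicOn E q) (q₀ : ZMod 3)
    (hout : ∀ y ∈ B, 2 ≤ (outArcs E y).card) (hin : ∀ y ∈ B, 2 ≤ (inArcs E y).card) :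
    (footprint B q q₀).card ≤ (inside E (footprint B q q₀)).card := by
  have hge := two_mul_card_inside_ge hE hq q₀ hout hin
  omega

/-- PHASE-CLASS DICHOTOMY.  Under the same hypotheses: either the phase is CONSTANT on `B`, or EVERY phase class
misses more than `c` vertices of `B` (no phase covers all but `c` of Bob's vertices: a "giant winding"). -/
theorem phase_classes {E : Finset (V × V)} {B : Finset V} (hE : ∀ e ∈ E, e.1 ∈ B ∧ e.2 ∈ B)
    {q : V → ZMod 3} (hq : CyclicOn E q) {δ c : ℕ}
    (hout : ∀ y ∈ B, δ ≤ (outArcs E y).card) (hin : ∀ y ∈ B, δ ≤ (inArcs E y).card)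
    (hsparse : LocallySparse E B δ c) :
    (∃ a : ZMod 3, ∀ y ∈ B, q y = a) ∨ ∀ a : ZMod 3, c < (footprint B q a).card := by
  by_cases hconst : ∃ a : ZMod 3, ∀ y ∈ B, q y = a
  · exact Or.inl hconst
  · right
    intro a
    rcases giant_footprint hE hq hout hin hsparse a with h | h
    · exfalso
      apply hconst
      refine ⟨a, fun y hy => ?_⟩
      by_contra hne
      have : y ∈ footprint B q a := mem_footprint.mpr ⟨hy, hne⟩
      rw [h] at this
      simp at this
    · exact h

/-! ## §5 From colourings: the phase rule is derived, not assumed -/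

section Colourings

variable [Fintype V]

/-- Bob's frame ARCS: ordered pairs of `B` that are edges of `β` with residues `r w = r u + 1`. -/
def arcSet (β : SimpleGraph V) [DecidableRel β.Adj] (r : V → ZMod 3) (B : Finset V) : Finset (V × V) :=
  (B ×ˢ B).filter fun e => β.Adj e.1 e.2 ∧ r e.2 = r e.1 + 1

theorem arcSet_inside (β : SimpleGraph V) [DecidableRel β.Adj] (r : V → ZMod 3) (B : Finset V) :
    ∀ e ∈ arcSet β r B, e.1 ∈ B ∧ e.2 ∈ B := by
  intro e he
  simp only [arcSet, Finset.mem_filter, Finset.mem_product] at he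
  exact he.1

/-- The phase `q = c - r` of a proper colouring obeys the cyclic rule on the arcs (via seat 2's
`IdeasR2s2g9.phase_step_of_proper`). -/
theorem cyclicOn_of_proper (β : SimpleGraph V) [DecidableRel β.Adj] (r : V → ZMod 3) (B : Finset V)
    (c : V → ZMod 3) (hc : ∀ u w, β.Adj u w → c u ≠ c w) :
    CyclicOn (arcSet β r B) (fun v => c v - r v) := by
  intro e he
  simp only [arcSet, Finset.mem_filter, Finset.mem_product] at he
  obtain ⟨_, hadj, harc⟩ := he
  have hprop : r e.1 + (c e.1 - r e.1) ≠ r e.2 + (c e.2 - r e.2) := by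
    rw [add_sub_cancel, add_sub_cancel]
    exact hc _ _ hadj
  exact phase_step_of_proper r (fun v => c v - r v) harc hprop

/-- GIANT FOOTPRINT FOR COLOURINGS.  `β` any graph whose edges live inside `B` or not (only its arcs inside `B` are
counted), `r` any residue function, `c` any proper `ZMod 3`-colouring of `β`: if every vertex of `B` has `≥ δ` out-arcs
and `≥ δ` in-arcs among Bob's frame arcs and these arcs are locally sparse at scale `c₀`, then for every base phase the
set of `B`-vertices whose phase `c - r` differs from it is empty or larger than `c₀`. -/
theorem giant_footprint_of_colouring (β : SimpleGraph V) [DecidableRel β.Adj] (r : V → ZMod 3) (B : Finset V)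
    (c : V → ZMod 3) (hc : ∀ u w, β.Adj u w → c u ≠ c w) {δ c₀ : ℕ}
    (hout : ∀ y ∈ B, δ ≤ (outArcs (arcSet β r B) y).card)
    (hin : ∀ y ∈ B, δ ≤ (inArcs (arcSet β r B) y).card)
    (hsparse : LocallySparse (arcSet β r B) B δ c₀) (q₀ : ZMod 3) :
    footprint B (fun v => c v - r v) q₀ = ∅ ∨ c₀ < (footprint B (fun v => c v - r v) q₀).card :=
  giant_footprint (arcSet_inside β r B) (cyclicOn_of_proper β r B c hc) hout hin hsparse q₀

/-- … and the dichotomy: the colouring is `r + constant` on `B`, or every phase class misses `> c₀` vertices of `B`. -/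
theorem phase_classes_of_colouring (β : SimpleGraph V) [DecidableRel β.Adj] (r : V → ZMod 3) (B : Finset V)
    (c : V → ZMod 3) (hc : ∀ u w, β.Adj u w → c u ≠ c w) {δ c₀ : ℕ}
    (hout : ∀ y ∈ B, δ ≤ (outArcs (arcSet β r B) y).card)
    (hin : ∀ y ∈ B, δ ≤ (inArcs (arcSet β r B) y).card)
    (hsparse : LocallySparse (arcSet β r B) B δ c₀) :
    (∃ a : ZMod 3, ∀ y ∈ B, c y - r y = a) ∨ ∀ a : ZMod 3, c₀ < (footprint B (fun v => c v - r v) a).card :=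
  phase_classes (arcSet_inside β r B) (cyclicOn_of_proper β r B c hc) hout hin hsparse

end Colourings

/-! ## §6 The constant case is one-sided (Alice repair-freeness) -/

/-- FROZEN SPLIT.  If the phase is constant `a` on `B` and Bob's graph `β` lives inside `B`, then `r + q` is proper on
the hybrid `α ⊔ β` iff it is proper on Alice's `α` and `β` has no `r`-site.  So the event "some frame admits a light
colouring with empty footprint" factors as (β site-free in that frame) ∧ (Alice's side admits a `B`-frozen winding):
the second factor is an ALICE-ONLY property — an affordable one-sided junta by the cell's law B-g14s2-2. -/
theorem frozen_split (α β : SimpleGraph V) (r q : V → ZMod 3) (B : Finset V) (a : ZMod 3)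
    (hβ : ∀ u w, β.Adj u w → u ∈ B ∧ w ∈ B) (hq : ∀ y ∈ B, q y = a) :
    (∀ u w, (α ⊔ β).Adj u w → r u + q u ≠ r w + q w) ↔
      (∀ u w, α.Adj u w → r u + q u ≠ r w + q w) ∧ (∀ u w, β.Adj u w → r u ≠ r w) := by
  constructor
  · intro h
    refine ⟨fun u w huw => h u w ((SimpleGraph.sup_adj _ _ _ _).mpr (Or.inl huw)), fun u w huw => ?_⟩
    have h' := h u w ((SimpleGraph.sup_adj _ _ _ _).mpr (Or.inr huw))
    rw [hq u (hβ u w huw).1, hq w (hβ u w huw).2] at h'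
    intro hr
    exact h' (by rw [hr])
  · rintro ⟨hα, hsite⟩ u w huw
    rcases (SimpleGraph.sup_adj _ _ _ _).mp huw with h | h
    · exact hα u w h
    · rw [hq u (hβ u w h).1, hq w (hβ u w h).2]
      intro heq
      exact hsite u w h (add_right_cancel heq)

/-! ## §6b ERRATUM / SCOPE (added the same day): graded frames make `δ ≥ 2` VACUOUS for normal systems

In a NORMAL cycle system every frame digraph is graded by height (`NormalGrading.foreign_step_graded`, seat 2 g14):
ruler-`k` arcs climb by one, every foreign arc points to the endpoint of SMALLER frame-`k` height.  Consequently the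
in-arcs of a vertex `y` come from `pred_k y` or from vertices of larger height, and the highest `B`-vertex of the ruler
has Bob in-degree `≤ 1` (symmetrically the lowest has out-degree `≤ 1`).  So the hypotheses `hin`/`hout` of
`giant_footprint` / `phase_classes` with `δ ≥ 2` are NEVER met by a nonempty cut of a normal system: for the species
μ_t° those two theorems are vacuous, and only the `δ = 1` statement `footprint_spans_arcs` (with BJ_1 bought as a CLASS
condition, memo v2 §3) and the abstract theorem for ungraded species remain in force.  The lemma below records the
obstruction in kernel form; the memo `BarrierNotesP4g17.md` v2 carries the corrected cost sheet. -/

/-- GRADED IN-DEGREE OBSTRUCTION.  If every in-arc of every vertex comes from its ruler predecessor `p y` or from a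
vertex of strictly larger height, then a `B`-vertex of maximal height in `B` has at most one Bob in-arc. -/
theorem inArcs_card_le_one_of_graded {E : Finset (V × V)} {B : Finset V} (hE : ∀ e ∈ E, e.1 ∈ B ∧ e.2 ∈ B)
    (ht : V → ℕ) (p : V → V) (hgraded : ∀ e ∈ E, ht e.2 < ht e.1 ∨ e.1 = p e.2)
    {y : V} (hmax : ∀ b ∈ B, ht b ≤ ht y) : (inArcs E y).card ≤ 1 := by
  apply Finset.card_le_one.mpr
  intro e he e' he'
  simp only [inArcs, Finset.mem_filter] at he he'
  have h1 : e.1 = p y := by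
    rcases hgraded e he.1 with h | h
    · exfalso
      have := hmax e.1 (hE e he.1).1
      rw [he.2] at h
      omega
    · rw [← he.2]; exact h
  have h1' : e'.1 = p y := by
    rcases hgraded e' he'.1 with h | h
    · exfalso
      have := hmax e'.1 (hE e' he'.1).1
      rw [he'.2] at h
      omega
    · rw [← he'.2]; exact h
  exact Prod.ext (h1.trans h1'.symm) (he.2.trans he'.2.symm)

/-- Hence `BJ_δ` with `δ ≥ 2` (in-degree form) is unsatisfiable on any nonempty cut of a graded frame. -/
theorem not_bj_two_of_graded {E : Finset (V × V)} {B : Finset V} (hE : ∀ e ∈ E, e.1 ∈ B ∧ e.2 ∈ B)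
    (ht : V → ℕ) (p : V → V) (hgraded : ∀ e ∈ E, ht e.2 < ht e.1 ∨ e.1 = p e.2)
    (hB : B.Nonempty) (hin : ∀ y ∈ B, 2 ≤ (inArcs E y).card) : False := by
  obtain ⟨y, hy, hmax⟩ := Finset.exists_max_image B ht hB
  have h := inArcs_card_le_one_of_graded hE ht p hgraded hmax
  have h2 := hin y hy
  omega

/-! ## §7 Reading for normal cycle systems (no new hypotheses; docstring only)

For an aligned hybrid `H = S_A ∪ S'[B]` of normal `t`-systems and a frame `k` with seam `{u_k, v_k} ⊆ A`, take
`r = pos^S_k mod 3` (`= pos^{S'}_k mod 3` on `B` by alignment).  Bob's frame arcs `arcSet (bobGraph S' B) r B` are: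
`y → succ'_k y` (own ruler step, both ends in `B`, not the wrap), and `succ'_j y → y` for `j ≠ k` (foreign steps of
`S'` inside `B`, which point to the `k`-EARLIER endpoint by normality, `NormalGrading.foreign_step_graded`); the only
`r`-site `S'[B]` can contain is the ruler-`k` wrap edge of `S'`.  The out/in-degrees in `giant_footprint` are the
columns `bob_out / bob_in` of the anatomy tables of IDEATION-CENSUS-r2s2g14 §7 C2, so:

* Type U/D repairs (relative to the bulk phase `q₀`: the terminator is the unique `Y₂`-vertex and has NO Bob in-arc,
  the chain's `B`-vertices form `Y₁` and have no Bob out-arc; measured footprints `|Y| ≤ 9`): impossible as soon as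
  `δ ≥ 1` (`in_closed` / `out_closed` alone), at every depth once `δ ≥ 3` + local sparsity;
* double-break `(2,2)` repairs (this seat's g17 notes): footprint `= (J₀ ∪ J₂) ∩ B` relative to the middle phase —
  same verdict;
* what the theorem cannot touch: colourings whose footprint exceeds `c(t)·n` in EVERY frame and EVERY normalisation
  (giant windings) — the residual P1.
-/

/-! ## §9 Darkness of a rectangle = a SIDE ASSIGNMENT of all vertex colourings (exact, elementary)

`(α ⊔ β)` is 3-colourable iff some `c : V → Fin 3` is proper for Alice's edges AND for Bob's edges.  Hence a rectangle
`𝓐 × 𝓑` is dark iff EVERY colouring `c` of the vertex set is refuted by the whole of one side: every `α ∈ 𝓐` has a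
`c`-monochromatic edge, or every `β ∈ 𝓑` has one.  The refuter's only freedom is the assignment `c ↦ side`; in the aligned
class and frame language (`§1–§6`) the colourings are the phase patterns `(Y₁, Y₂)` and "refuted by α" = "not α-closed".
Memo v2 §4 uses this to show that the threshold patterns present on BOTH sides force a size-segregated assignment. -/

theorem colorable_sup_iff (α β : SimpleGraph V) (n : ℕ) :
    (α ⊔ β).Colorable n ↔
      ∃ c : V → Fin n, (∀ u w, α.Adj u w → c u ≠ c w) ∧ (∀ u w, β.Adj u w → c u ≠ c w) := by
  constructor
  · rintro ⟨C⟩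
    exact ⟨C, fun u w h => C.valid ((SimpleGraph.sup_adj α β u w).mpr (Or.inl h)),
      fun u w h => C.valid ((SimpleGraph.sup_adj α β u w).mpr (Or.inr h))⟩
  · rintro ⟨c, hα, hβ⟩
    refine ⟨SimpleGraph.Coloring.mk c ?_⟩
    intro u w h
    rcases (SimpleGraph.sup_adj α β u w).mp h with h | h
    · exact hα u w h
    · exact hβ u w h

/-- Pure logic: a rectangle avoids `{(a,b) : ∃ p, A a p ∧ B b p}` iff every `p` is excluded by one whole side. -/
theorem rectangle_avoids_iff {ι κ P : Type*} (𝓐 : Set ι) (𝓑 : Set κ) (cA : ι → P → Prop) (cB : κ → P → Prop) :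
    (∀ a ∈ 𝓐, ∀ b ∈ 𝓑, ¬ ∃ p, cA a p ∧ cB b p) ↔
      ∀ p, (∀ a ∈ 𝓐, ¬ cA a p) ∨ (∀ b ∈ 𝓑, ¬ cB b p) := by
  constructor
  · intro h p
    by_contra hc
    push Not at hc
    obtain ⟨⟨a, ha, hca⟩, ⟨b, hb, hcb⟩⟩ := hc
    exact h a ha b hb ⟨p, hca, hcb⟩
  · rintro h a ha b hb ⟨p, hca, hcb⟩
    rcases h p with h' | h'
    · exact h' a ha hca
    · exact h' b hb hcb

/-- DARK RECTANGLE ⟺ SIDE ASSIGNMENT.  `𝓐 × 𝓑` is dark (no pair has a 3-colourable union) iff every `c : V → Fin 3` is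
monochromatic on some edge of EVERY `α ∈ 𝓐`, or on some edge of EVERY `β ∈ 𝓑`. -/
theorem dark_iff_assignment (𝓐 𝓑 : Set (SimpleGraph V)) :
    (∀ α ∈ 𝓐, ∀ β ∈ 𝓑, ¬ (α ⊔ β).Colorable 3) ↔
      ∀ c : V → Fin 3, (∀ α ∈ 𝓐, ∃ u w, α.Adj u w ∧ c u = c w) ∨ (∀ β ∈ 𝓑, ∃ u w, β.Adj u w ∧ c u = c w) := by
  have key := rectangle_avoids_iff 𝓐 𝓑 (fun α (c : V → Fin 3) => ∀ u w, α.Adj u w → c u ≠ c w)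
    (fun β (c : V → Fin 3) => ∀ u w, β.Adj u w → c u ≠ c w)
  simp only [colorable_sup_iff]
  rw [key]
  refine forall_congr' fun c => ?_
  constructor
  · rintro (h | h)
    · left; intro α hα; have := h α hα; push Not at this; exact this
    · right; intro β hβ; have := h β hβ; push Not at this; exact this
  · rintro (h | h)
    · left; intro α hα; push Not; exact h α hα
    · right; intro β hβ; push Not; exact h β hβ

end Summit.PneNP.PneNP.Cruxes.FoolingMeasure.P4g17
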